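import Literature.NumberTheory.PAdicHodge.TateH1LogChiLine
import Literature.NumberTheory.PAdicHodge.TateCocycleTransferContinuous
import Literature.NumberTheory.PAdicHodge.TateLogCyclotomicClass
import HarnessLib

/-!
# Tate 1967 §3.3 Theorem 1 over a `p`-adic field `F`: `H¹_cont(Γ_F, ℂ_F) = F · [log χ_F]`, GRANTED (TS1)

Assembly of three tree files: `TateH1LogChiLine` (edix-p1: over the base `K₀ ≅ ℚ_p`, every continuous
`1`-cocycle `G₀ = Gal(F̄/K₀) → ℂ_F` is `c · log χ + ∂b` granted the Tate–Sen axiom (TS1) for `ℂ_F`),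
`TateCocycleTransferContinuous` (edix-p2: the degree-one transfer `Γ_F ≤ G₀` for continuous twisted cocycles,
`TateDescent.exists_eq_twistedCoboundary_of_base`) and `TateLogCyclotomicClass` (the class of `log χ_F` is not
a coboundary, `CompletedAlgClosure.not_exists_smul_eq_add_mul_logCyclotomic`). Notation: `Γ_F = Gal(F̄/F)`
(`absoluteGaloisGroup F`, Krull topology), `ℂ_F = CompletedAlgClosure F`, `log χ_F = logCyclotomic p`
(`ℚ_p`-valued, read in `ℂ_F` through `ℚ_p → F → ℂ_F`), (TS1) displayed as the hypothesis `hTS` of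
`TateSen.baseKer_exists_eq_smul_sub_of_TS1`.

* `TateH1.ι_logChi_toBase` — `ι(log χ(toBase σ)) = log χ_F(σ)` in `ℂ_F` (`χ(toBase σ) = χ_F(σ)`, tree).
* `TateH1.exists_eq_twistedCoboundary_zero_add_mul_logChi_of_TS1` — the `G₀`-statement in the exact input shape of
  the transfer (`j = 0`, `ℓ = ι ∘ log χ`).
* **`TateH1.exists_eq_coboundary_add_mul_logCyclotomic_of_TS1`** — every continuous `1`-cocycle
  `c : Γ_F → ℂ_F` is `c(σ) = σ • B − B + A · log χ_F(σ)` with `B ∈ ℂ_F`, `A ∈ F`. GRANTED (TS1).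
* `TateH1.coeff_logCyclotomic_unique` — the coefficient `A` is unique (UNCONDITIONAL).
* **`TateH1.existsUnique_coeff_logCyclotomic_of_TS1`** — `H¹_cont(Γ_F, ℂ_F) ≅ F`, `[c] ↦ A`: Tate's Theorem 1
  (`H⁰` part aside) for the `p`-adic field `F`, GRANTED (TS1). This is the `H¹(K, ℂ_p) = K · log χ` input of
  Kato 1993 II §1.2.3 (b) (`hasDualExp_of_isDeRham` programme, bricks b5 ∘ b6; (TS1) = brick b2).

No named fact besides the displayed hypothesis `hTS`; no `sorry`, no definition.

## References
* J. Tate, *p-divisible groups* (1967), §3.3 Theorem 1. [Tate1967]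
* J.-M. Fontaine, Y. Ouyang, *Theory of p-adic Galois representations*, §3.2 Thm. 3.21. [FontaineOuyang2022]
* K. Kato, *Lectures on the approach to Iwasawa theory for Hasse–Weil L-functions via B_dR* (1993), Ch. II §1.2. [Kato1993LNM1553]
-/

noncomputable section

open ValuativeRel Field UniformSpace Filter Topology

namespace Literature.NumberTheory.PAdicHodge

open Literature.NumberTheory.GaloisRepresentations
open Literature.NumberTheory.GaloisRepresentations.IsNonarchimedeanLocalField
open CyclotomicTower TateTrace

variable {F : Type} [Field F] [ValuativeRel F] [TopologicalSpace F] [IsNonarchimedeanLocalField F]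
  [CharZero F] {p : ℕ} [Fact p.Prime] (hp : valuation F p < 1)

namespace TateH1

/-- `ι(log χ(toBase σ)) = log χ_F(σ)` read in `ℂ_F` (`χ(toBase σ) = χ_F(σ)`, tree
`BaseGaloisGroup.baseCyclotomicCharacter_toBase`; `ι ∘ toPadic⁻¹ = (ℚ_p → F → ℂ_F)`, tree `ι_toPadic_symm`).
[cite: Kato1993LNM1553, Ch. II §1.2.2] -/
theorem ι_logChi_toBase (σ : absoluteGaloisGroup F) :
    ι hp ((PadicBase.toPadic hp).symm (Literature.IUT.LogVolume.unitLog
      (((BaseGaloisGroup.baseCyclotomicCharacter hp (BaseGaloisGroup.toBase hp σ) : ℤ_[p]ˣ) : ℤ_[p]) : ℚ_[p]))) =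
      algebraMap F (CompletedAlgClosure F) (LocalField.padicRingHom F p hp (logCyclotomic p σ)) := by
  rw [BaseGaloisGroup.baseCyclotomicCharacter_toBase, ι_toPadic_symm]
  rfl

/-- The `G₀`-level theorem `H¹_cont(G₀, ℂ_F) = ℚ_p · log χ` (granted (TS1)) in the input shape of the transfer
`TateDescent.exists_eq_twistedCoboundary_of_base` (`j = 0`, `ℓ = ι ∘ log χ`). [cite: Tate1967, §3.3 Theorem 1] -/
theorem exists_eq_twistedCoboundary_zero_add_mul_logChi_of_TS1
    (hTS : ∃ K : ℝ, ∀ U : OpenSubgroup (BaseGaloisGroup.baseCyclotomicCharacter hp).ker,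
      ∃ α : CompletedAlgClosure F, (∀ u ∈ U, u • α = α) ∧ ‖α‖ ≤ K ∧
        ∑ᶠ q : (BaseGaloisGroup.baseCyclotomicCharacter hp).ker ⧸ U.toSubgroup, q.out • α = 1)
    (C : BaseGaloisGroup hp → CompletedAlgClosure F)
    (hC : ∀ g g' : BaseGaloisGroup hp, C (g * g') = C g + ι hp (TateDescent.W hp g) ^ (0 : ℤ) * (g • C g'))
    (hcont : Continuous C) :
    ∃ (b : CompletedAlgClosure F) (a : PadicBase F p hp), ∀ g : BaseGaloisGroup hp,
      C g = ι hp (TateDescent.W hp g) ^ (0 : ℤ) * (g • b) - b + ι hp a *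
        ι hp ((PadicBase.toPadic hp).symm (Literature.IUT.LogVolume.unitLog
          (((BaseGaloisGroup.baseCyclotomicCharacter hp g : ℤ_[p]ˣ) : ℤ_[p]) : ℚ_[p]))) := by
  have hcoc : ∀ g g' : BaseGaloisGroup hp, C (g * g') = C g + g • C g' := fun g g' => by
    simpa only [zpow_zero, one_mul] using hC g g'
  obtain ⟨c, b, hb⟩ := exists_eq_mul_logChi_add_coboundary_of_TS1 hp hTS hcoc hcont
  refine ⟨b, c, fun g => ?_⟩
  have hmul : ∀ x y : PadicBase F p hp, ι hp (x * y) = ι hp x * ι hp y := fun x y => map_mul (ιHom hp) x y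
  rw [hb g, zpow_zero, one_mul, hmul]
  ring

variable {c : absoluteGaloisGroup F → CompletedAlgClosure F}

/-- **Tate 1967 §3.3 Theorem 1 over `F`, GRANTED (TS1): every continuous `1`-cocycle `c : Γ_F → ℂ_F` is
`c(σ) = σ • B − B + A · log χ_F(σ)`** with `B ∈ ℂ_F`, `A ∈ F` (`log χ_F = logCyclotomic p`, read in `ℂ_F`).
The `G₀`-level line (`TateH1LogChiLine`, granted (TS1)) transferred along `Γ_F ≤ G₀ = Gal(F̄/ℚ_p)` by
`TateDescent.exists_eq_twistedCoboundary_of_base` (edix-p2). CONDITIONAL on (TS1) only (hypothesis `hTS`).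
[cite: Tate1967, §3.3 Theorem 1] [cite: FontaineOuyang2022, §3.2 Thm. 3.21] -/
theorem exists_eq_coboundary_add_mul_logCyclotomic_of_TS1
    (hTS : ∃ K : ℝ, ∀ U : OpenSubgroup (BaseGaloisGroup.baseCyclotomicCharacter hp).ker,
      ∃ α : CompletedAlgClosure F, (∀ u ∈ U, u • α = α) ∧ ‖α‖ ≤ K ∧
        ∑ᶠ q : (BaseGaloisGroup.baseCyclotomicCharacter hp).ker ⧸ U.toSubgroup, q.out • α = 1)
    (hc : ∀ σ τ : absoluteGaloisGroup F, c (σ * τ) = c σ + σ • c τ) (hcont : Continuous c) :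
    ∃ (B : CompletedAlgClosure F) (A : F), ∀ σ : absoluteGaloisGroup F,
      c σ = σ • B - B + algebraMap F (CompletedAlgClosure F) A *
        algebraMap F (CompletedAlgClosure F) (LocalField.padicRingHom F p hp (logCyclotomic p σ)) := by
  have hc' : ∀ σ τ : absoluteGaloisGroup F,
      c (σ * τ) = c σ + ι hp (TateDescent.W hp (BaseGaloisGroup.toBase hp σ)) ^ (0 : ℤ) * (σ • c τ) :=
    fun σ τ => by rw [zpow_zero, one_mul]; exact hc σ τ
  obtain ⟨B, A, h⟩ := TateDescent.exists_eq_twistedCoboundary_of_base hp 0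
    (fun g => ι hp ((PadicBase.toPadic hp).symm (Literature.IUT.LogVolume.unitLog
      (((BaseGaloisGroup.baseCyclotomicCharacter hp g : ℤ_[p]ˣ) : ℤ_[p]) : ℚ_[p]))))
    (fun C hC hCc => exists_eq_twistedCoboundary_zero_add_mul_logChi_of_TS1 hp hTS C hC hCc) hc' hcont
  refine ⟨B, A, fun σ => ?_⟩
  rw [h σ, zpow_zero, one_mul, ι_logChi_toBase]

/-- **The coefficient of `log χ_F` is unique** (UNCONDITIONAL): if `c = ∂B + A · log χ_F = ∂B' + A' · log χ_F`
then `A = A'` — otherwise `(A − A') · log χ_F = ∂(B' − B)` contradicts the tree's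
`CompletedAlgClosure.not_exists_smul_eq_add_mul_logCyclotomic`. [cite: Tate1967, §3.3 Theorem 1] -/
theorem coeff_logCyclotomic_unique {B B' : CompletedAlgClosure F} {A A' : F}
    (h : ∀ σ : absoluteGaloisGroup F, c σ = σ • B - B + algebraMap F (CompletedAlgClosure F) A *
      algebraMap F (CompletedAlgClosure F) (LocalField.padicRingHom F p hp (logCyclotomic p σ)))
    (h' : ∀ σ : absoluteGaloisGroup F, c σ = σ • B' - B' + algebraMap F (CompletedAlgClosure F) A' *
      algebraMap F (CompletedAlgClosure F) (LocalField.padicRingHom F p hp (logCyclotomic p σ))) :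
    A = A' := by
  by_contra hne
  refine CompletedAlgClosure.not_exists_smul_eq_add_mul_logCyclotomic hp (a := A - A') (sub_ne_zero.mpr hne)
    ⟨B' - B, fun σ => ?_⟩
  have e := (h σ).symm.trans (h' σ)
  rw [map_sub, smul_sub]
  linear_combination (-1 : CompletedAlgClosure F) * e

/-- **`H¹_cont(Γ_F, ℂ_F) ≅ F` on the class of `log χ_F`, GRANTED (TS1)** (Tate 1967 §3.3 Theorem 1 for the
`p`-adic field `F`): every continuous `1`-cocycle `c : Γ_F → ℂ_F` determines a UNIQUE `A ∈ F` with
`c = ∂B + A · log χ_F` for some `B ∈ ℂ_F`. Existence: `exists_eq_coboundary_add_mul_logCyclotomic_of_TS1`;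
uniqueness: `coeff_logCyclotomic_unique`. CONDITIONAL on (TS1) only (hypothesis `hTS`).
[cite: Tate1967, §3.3 Theorem 1] [cite: FontaineOuyang2022, §3.2 Thm. 3.21] [cite: Kato1993LNM1553, Ch. II §1.2.3] -/
theorem existsUnique_coeff_logCyclotomic_of_TS1
    (hTS : ∃ K : ℝ, ∀ U : OpenSubgroup (BaseGaloisGroup.baseCyclotomicCharacter hp).ker,
      ∃ α : CompletedAlgClosure F, (∀ u ∈ U, u • α = α) ∧ ‖α‖ ≤ K ∧
        ∑ᶠ q : (BaseGaloisGroup.baseCyclotomicCharacter hp).ker ⧸ U.toSubgroup, q.out • α = 1)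
    (hc : ∀ σ τ : absoluteGaloisGroup F, c (σ * τ) = c σ + σ • c τ) (hcont : Continuous c) :
    ∃! A : F, ∃ B : CompletedAlgClosure F, ∀ σ : absoluteGaloisGroup F,
      c σ = σ • B - B + algebraMap F (CompletedAlgClosure F) A *
        algebraMap F (CompletedAlgClosure F) (LocalField.padicRingHom F p hp (logCyclotomic p σ)) := by
  obtain ⟨B, A, h⟩ := exists_eq_coboundary_add_mul_logCyclotomic_of_TS1 hp hTS hc hcont
  exact ⟨A, ⟨B, h⟩, fun A' ⟨B', h'⟩ => coeff_logCyclotomic_unique hp h' h⟩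

end TateH1

end Literature.NumberTheory.PAdicHodge

end
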